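import Literature.MathematicalPhysics.QuantumFieldTheory.Balaban1983to89.B4ConstantsWindow
import Literature.MathematicalPhysics.QuantumFieldTheory.Balaban1983to89.B4Eq12ExpFlow

/-!
# `Balaban1983to89.B4Lemma21RegularWindow` — T. Bałaban, *Regularity and decay of lattice Green's functions*, Commun.
# Math. Phys. **89** (1983) 571–597 [Balaban1983RegularityDecay] (= B4): Lemma 2.1 (2.15) p. 577 and the in-text claim
# (1.8) p. 573 AT A REGULAR `A ≠ 0` WITH ONE SET OF CONSTANTS FOR ALL `a_k ∈ [a₋, a₊]`

statement-level skeleton of published theorems with citation tags; proofs where landed; nothing here is a claim about the Yang–Mills mass gap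

PDF held: `paper:balaban1983-cmp89-regularity-decay` (journal page = PDF page + 570), pp. 573, 577, 579–580 [PDF 3, 7,
9–10]; read on the ×2 renders under `…/b2b-balaban-ref1/pages/1983-cmp89-regularity-decay/`.

CITATION HEADER (lean-in-tree rule).  Cell `lit-balaban` (HOME `run/shared/lean/pub/lit-balaban/`), Phase-2 proof seat
**p17** gen 3 (unit `lit-balaban-p17-g3`), file 10 — rows **B4.Lem2.1** (`B4.Lemma21Printed`; b04's regular-field leaf
`B4Lemma21Region.lemma21Printed_regularRegion`, witness `c₂ = 4/min(2,a)` at ONE value `a = a_k`) and **B4.Eq1.8**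
(`B4.Claim18Printed`; b04's `B4Lower18RegularRegion.claim18Printed_regularRegion`, witness `γ₀ = min(2,a)/4`); owner r01.
p. 573: *"The constant γ₀ is independent of the lattice spacing η, as well as of Ω and of A"*, p. 577 Lemma 2.1: *"a
positive constant c₂ independent of k, □"* — independent of `k`, hence UNIFORM IN `a_k ∈ [a₋, a₊]` («a_k is a constant
proportional to a», (1.14) p. 573).  With `min(2,a₋)/4 ≤ min(2,a_k)/4` and the window threshold of file 8a
(`B4ConstantsWindow.threshold_window`) b04's carrier-level bounds (`green_sq_le_region`, `deriv_green_sq_le_region`,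
`green_derivT_sq_le_region`, `deriv_green_derivT_sq_le_region`, `lower18_regular_region_printed`) at each `a_k` give
the common witnesses `c₂ = 4/min(2,a₋)`, `γ₀ = min(2,a₋)/4`, `e₁` = the window threshold.  Nothing of b04 is restated:
the window families' carriers ARE b04's carriers at the instance's `a_k` (definitionally).

WHAT IS KERNEL-CHECKED (zero `sorry`, standard axioms, no `Prop`-valued definition): `RegularCubeInstanceW`,
`regularCubeW`, **`lemma21Printed_regularRegionW : B4.Lemma21Printed (regularCubeW F a₋ a₊ c β M K)`** (+ `_rot`, `_exp`,
non-vacuity `linInstW_meets`); `RegularRegionInstanceW`, `regularRegionSettingW`,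
**`claim18Printed_regularRegionW : B4.Claim18Printed (regularRegionSettingW F a₋ a₊ c β)`** (+ `_rot`, `_exp`).
HONEST SCOPE.  As b04: every finite union of unit blocks (the «few large blocks» antecedent carried, not used), (1.7) in
lattice units on `□`/`Ω`, `γ₀`'s VALUE is the lineage's; window `0 < a₋ ≤ a₊`; constants depend on `(d, a₋, c, β, ℓ)`.
Unit `lit-balaban-p17-g3`.
DOCFIX 2026-08-22 (lit-balaban-p17 gen 26, on r04 g22 `CITELOC-AUDIT-g22.md` §3, verified on the text layer of [Balaban1983RegularityDecay]): citation locators only — «(1.7) p.573» ∕ «(1.7)–(1.8) p.573» → «(1.7) p.572» ∕ «(1.7) p.572, (1.8) p.573» at four `[cite:]` tags; every declaration byte-identical.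
-/

namespace Literature.MathematicalPhysics.QuantumFieldTheory.Balaban1983to89.B4Lemma21RegularWindow

open Matrix
open Literature.MathematicalPhysics.QuantumFieldTheory.Balaban1983to89
open Literature.MathematicalPhysics.QuantumFieldTheory.Balaban1983to89.B4GaugeCovariance (OrthFlow)
open Literature.MathematicalPhysics.QuantumFieldTheory.Balaban1983to89.B4Lower18Regular (e1 rot_lipschitz
  dotProduct_self_nonneg')
open Literature.MathematicalPhysics.QuantumFieldTheory.Balaban1983to89.B4Lower18 (fineDom)
open Literature.MathematicalPhysics.QuantumFieldTheory.Balaban1983to89.B4Lower18RegularRegion (RegularRegionInstance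
  regularRegionSetting lower18_regular_region_printed)
open Literature.MathematicalPhysics.QuantumFieldTheory.Balaban1983to89.B4Lemma21Region (RegularCubeInstance regularCube
  regularCube_regular_iff scale_sq scale_one scale_zero green_sq_le_region deriv_green_sq_le_region
  green_derivT_sq_le_region deriv_green_derivT_sq_le_region linInst linInst_meets)
open Literature.MathematicalPhysics.QuantumFieldTheory.Balaban1983to89.B4ConstantsWindow (threshold_window)
open Literature.MathematicalPhysics.QuantumFieldTheory.Balaban1983to89.B4Eq12ExpFlow (expFlow expFlow_ell_nonneg
  expFlow_lipschitz)

noncomputable section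

variable {d : ℕ} {ι : Type} [Fintype ι] [DecidableEq ι]

/-! ## §1. Lemma 2.1 (2.15) at a regular `A ≠ 0`, uniformly in `a_k ∈ [a₋, a₊]` -/

/-- ONE INSTANCE: b04's regular-field cube instance (mesh, unit labels of `□`, charge, vector field, mass) together with a
value `a_k ∈ [a₋, a₊]` of the (1.14)-parameter. [cite: Balaban1983RegularityDecay, Lemma 2.1 p.577, (1.14) p.573 «a_k is a constant proportional to a»] -/
structure RegularCubeInstanceW (d : ℕ) (aminus aplus : ℝ) extends RegularCubeInstance d where
  ak : ℝ
  hak : aminus ≤ ak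
  hak' : ak ≤ aplus

/-- **b04's REGULAR-FIELD CUBE CARRIERS WITH `a_k` IN A WINDOW**: at the index `i` the carrier is
`regularCube F i.ak c β M K i` (definitionally). [cite: Balaban1983RegularityDecay, Lemma 2.1 (2.15) p.577, dictionary] -/
def regularCubeW (F : OrthFlow ι) (aminus aplus c β : ℝ) (M K : ℕ) (i : RegularCubeInstanceW d aminus aplus) :
    B4.CubeSetting :=
  regularCube F i.ak c β M K i.toRegularCubeInstance

/-- **LEMMA 2.1 (2.15) AT A REGULAR `A ≠ 0`, UNIFORMLY IN `a_k ∈ [a₋, a₊]`** (typed `B4.Lemma21Printed` on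
`regularCubeW`): for a Lipschitz orthogonal flow, `0 < a₋ ≤ a₊`, `c ≥ 0`, `β > 0`, any large-block data `M, K`: with
`c₂ = 4/min(2,a₋)` and `e₁` = the window threshold (BOTH INDEPENDENT OF `a_k`), every instance — every `a_k ∈ [a₋,a₊]`,
mesh, finite union `□` of unit blocks, mass, vector field regular (1.7) with constant `c`, charge `0 < e ≤ e₁` — obeys the
four bounds (2.15).  b04's carrier-level bounds at `a_k`, scaled to `γ₀ = min(2,a₋)/4 ≤ min(2,a_k)/4 + m²`.
[cite: Balaban1983RegularityDecay, Lemma 2.1 (2.15) p.577 «a positive constant c₂ independent of k, □»; proof pp.579–580] -/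
theorem lemma21Printed_regularRegionW (F : OrthFlow ι) {ℓ : ℝ} (hℓ : 0 ≤ ℓ)
    (hLip : ∀ t (v : ι → ℝ), ((F.U t - 1) *ᵥ v) ⬝ᵥ ((F.U t - 1) *ᵥ v) ≤ (ℓ * t) ^ 2 * (v ⬝ᵥ v))
    {aminus aplus : ℝ} (ham : 0 < aminus) (hle : aminus ≤ aplus) {c : ℝ} (hc : 0 ≤ c) {β : ℝ} (hβ : 0 < β)
    (M K : ℕ) : B4.Lemma21Printed (regularCubeW (d := d) F aminus aplus c β M K) := by
  obtain ⟨e₁, he₁, hsm⟩ := threshold_window ℓ ((d + 1) * c) ham hle hβ d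
  have hγ0 : 0 < min 2 aminus / 4 := div_pos (lt_min two_pos ham) four_pos
  have hγ1 : min 2 aminus / 4 ≤ 1 := by have := min_le_left 2 aminus; linarith
  refine ⟨(min 2 aminus / 4)⁻¹, e₁, inv_pos.2 hγ0, he₁, ?_⟩
  intro i _ hreg he hle' k μ ν f
  change 0 < i.e at he
  change i.e ≤ e₁ at hle'
  have hreg' := (regularCube_regular_iff F i.ak c β M K i.toRegularCubeInstance).1 hreg
  have ha : 0 < i.ak := ham.trans_le i.hak
  have hsm' : ℓ ^ 2 * ((d + 1) * c * i.e ^ β) ^ 2 * (d + 1) * (1 + i.ak * (d + 1)) ≤ min 2 i.ak / 4 := by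
    have := hsm i.e he hle' i.ak i.hak i.hak'
    simpa only [mul_assoc] using this
  have hγle : min 2 aminus / 4 ≤ min 2 i.ak / 4 + i.m2 := by
    have h1 : min 2 aminus / 4 ≤ min 2 i.ak / 4 := div_le_div_of_nonneg_right (min_le_min le_rfl i.hak) (by norm_num)
    linarith [i.hm]
  have hff : 0 ≤ f ⬝ᵥ f := dotProduct_self_nonneg' f
  have key : (i.opX F i.ak k μ ν f) ⬝ᵥ (i.opX F i.ak k μ ν f) ≤ (min 2 aminus / 4)⁻¹ ^ 2 * (f ⬝ᵥ f) := by
    have hk : k = 0 ∨ k = 1 ∨ k = 2 ∨ k = 3 := by fin_cases k <;> simp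
    rcases hk with rfl | rfl | rfl | rfl
    · rw [RegularCubeInstance.opX_zero]
      exact scale_sq hγ0 hγle (dotProduct_self_nonneg' _)
        (green_sq_le_region F hℓ hLip he i.hn ha i.hm i.Ωc hc hreg' hsm' f)
    · rw [RegularCubeInstance.opX_one]
      exact scale_one hγ0 hγ1 hγle (dotProduct_self_nonneg' _)
        (deriv_green_sq_le_region F hℓ hLip he i.hn ha i.hm i.Ωc hc hreg' hsm' μ f)
    · rw [RegularCubeInstance.opX_two]
      exact scale_one hγ0 hγ1 hγle (dotProduct_self_nonneg' _)
        (green_derivT_sq_le_region F hℓ hLip he i.hn ha i.hm i.Ωc hc hreg' hsm' μ f)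
    · rw [RegularCubeInstance.opX_three]
      exact scale_zero hγ0 hγ1 hff
        (deriv_green_derivT_sq_le_region F hℓ hLip he i.hn ha i.hm i.Ωc hc hreg' hsm' μ ν f)
  show Real.sqrt ((i.opX F i.ak k μ ν f) ⬝ᵥ (i.opX F i.ak k μ ν f)) ≤ (min 2 aminus / 4)⁻¹ * Real.sqrt (f ⬝ᵥ f)
  calc Real.sqrt ((i.opX F i.ak k μ ν f) ⬝ᵥ (i.opX F i.ak k μ ν f))
      ≤ Real.sqrt ((min 2 aminus / 4)⁻¹ ^ 2 * (f ⬝ᵥ f)) := Real.sqrt_le_sqrt key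
    _ = (min 2 aminus / 4)⁻¹ * Real.sqrt (f ⬝ᵥ f) := by
        rw [Real.sqrt_mul (sq_nonneg _), Real.sqrt_sq (inv_nonneg.2 hγ0.le)]

/-- the window Lemma 2.1 for the ROTATION FLOW (`N = 2`, `ℓ = 1`). [cite: Balaban1983RegularityDecay, Lemma 2.1 (2.15) p.577] -/
theorem lemma21Printed_regularRegionW_rot {aminus aplus : ℝ} (ham : 0 < aminus) (hle : aminus ≤ aplus) {c : ℝ}
    (hc : 0 ≤ c) {β : ℝ} (hβ : 0 < β) (M K : ℕ) :
    B4.Lemma21Printed (regularCubeW (d := d) OrthFlow.rot aminus aplus c β M K) :=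
  lemma21Printed_regularRegionW OrthFlow.rot zero_le_one rot_lipschitz ham hle hc hβ M K

/-- the window Lemma 2.1 for the flow `U = e^{tq}` of (1.2), ANY antisymmetric `q` (any `N`; r01's `expFlow_lipschitz`).
[cite: Balaban1983RegularityDecay, Lemma 2.1 (2.15) p.577; (1.2) p.572] -/
theorem lemma21Printed_regularRegionW_exp (q : Matrix ι ι ℝ) (hq : qᵀ = -q) {aminus aplus : ℝ} (ham : 0 < aminus)
    (hle : aminus ≤ aplus) {c : ℝ} (hc : 0 ≤ c) {β : ℝ} (hβ : 0 < β) (M K : ℕ) :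
    B4.Lemma21Printed (regularCubeW (d := d) (expFlow q hq) aminus aplus c β M K) :=
  lemma21Printed_regularRegionW (expFlow q hq) (expFlow_ell_nonneg q) (expFlow_lipschitz q hq) ham hle hc hβ M K

/-- b04's linear-field cube instance at a given `a_k` of the window. [cite: Balaban1983RegularityDecay, (1.7) p.572, (1.14) p.573] -/
def linInstW (d : ℕ) {aminus aplus ak : ℝ} (hak : aminus ≤ ak) (hak' : ak ≤ aplus) {n : ℕ} (hn : 1 ≤ n) (M : ℕ)
    {m2 : ℝ} (hm : 0 ≤ m2) (lam e : ℝ) : RegularCubeInstanceW d aminus aplus :=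
  { linInst d hn M hm lam e with ak := ak, hak := hak, hak' := hak' }

/-- **NON-VACUITY**: for EVERY threshold `e₁ > 0`, every `a_k ∈ [a₋,a₊]`, every `M, K ≥ 1`, mesh and mass, the
linear-field cube instance with charge `e₁` meets `fewLargeBlocks`, `regular` and `0 < e ≤ e₁` (b04's `linInst_meets`).
[cite: Balaban1983RegularityDecay, (1.7) p.572] -/
theorem linInstW_meets (F : OrthFlow ι) {aminus aplus ak : ℝ} (hak : aminus ≤ ak) (hak' : ak ≤ aplus) {c : ℝ}
    (hc : 0 ≤ c) (β : ℝ) {M K : ℕ} (hM : 1 ≤ M) (hK : 1 ≤ K) {n : ℕ} (hn : 1 ≤ n) {m2 : ℝ} (hm : 0 ≤ m2) {e₁ : ℝ}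
    (he₁ : 0 < e₁) :
    (regularCubeW F aminus aplus c β M K (linInstW d hak hak' hn M hm (c * e₁ ^ (β - 1) / n) e₁)).fewLargeBlocks ∧
      (regularCubeW F aminus aplus c β M K (linInstW d hak hak' hn M hm (c * e₁ ^ (β - 1) / n) e₁)).regular ∧
      0 < (regularCubeW F aminus aplus c β M K (linInstW d hak hak' hn M hm (c * e₁ ^ (β - 1) / n) e₁)).e ∧
      (regularCubeW F aminus aplus c β M K (linInstW d hak hak' hn M hm (c * e₁ ^ (β - 1) / n) e₁)).e ≤ e₁ :=
  linInst_meets (d := d) F ak hc β hM hK hn hm he₁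

/-! ## §2. The in-text claim (1.8) at a regular `A ≠ 0`, uniformly in `a_k ∈ [a₋, a₊]` -/

/-- ONE INSTANCE: b04's regular-region instance (mesh, unit labels of `Ω`, charge, vector field) together with a value
`a_k ∈ [a₋, a₊]`. [cite: Balaban1983RegularityDecay, (1.7) p.572, (1.8) p.573, (1.14) p.573] -/
structure RegularRegionInstanceW (d : ℕ) (aminus aplus : ℝ) extends RegularRegionInstance d where
  ak : ℝ
  hak : aminus ≤ ak
  hak' : ak ≤ aplus

/-- **b04's REGULAR-REGION CARRIERS WITH `a_k` IN A WINDOW**: at the index `i` the carrier is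
`regularRegionSetting F i.ak c β i` (definitionally). [cite: Balaban1983RegularityDecay, (1.7) p.572, (1.8) p.573, dictionary] -/
def regularRegionSettingW (F : OrthFlow ι) (aminus aplus c β : ℝ) (i : RegularRegionInstanceW d aminus aplus) :
    B4.EtaSetting :=
  regularRegionSetting F i.ak c β i.toRegularRegionInstance

/-- **THE IN-TEXT CLAIM (1.8) AT A REGULAR `A ≠ 0`, UNIFORMLY IN `a_k ∈ [a₋, a₊]`** (typed `B4.Claim18Printed` on
`regularRegionSettingW`): *"there exists a positive constant γ₀ such that for e sufficiently small and for a regular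
vector field A, −Δ^{η,N}_{A,Ω} + a_kP_k(A) ≥ γ₀I (1.8) … The constant γ₀ is independent of the lattice spacing η, as well
as of Ω and of A"* — with `γ₀ = min(2,a₋)/4` and `e₁` = the window threshold, BOTH INDEPENDENT OF `a_k`: b04's
`lower18_regular_region_printed` at `a_k` (`γ = min(2,a_k)/4 ≥ γ₀`). [cite: Balaban1983RegularityDecay, (1.8) p.573] -/
theorem claim18Printed_regularRegionW (F : OrthFlow ι) {ℓ : ℝ} (hℓ : 0 ≤ ℓ)
    (hLip : ∀ t (v : ι → ℝ), ((F.U t - 1) *ᵥ v) ⬝ᵥ ((F.U t - 1) *ᵥ v) ≤ (ℓ * t) ^ 2 * (v ⬝ᵥ v))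
    {aminus aplus : ℝ} (ham : 0 < aminus) (hle : aminus ≤ aplus) {c : ℝ} (hc : 0 ≤ c) {β : ℝ} (hβ : 0 < β) :
    B4.Claim18Printed (regularRegionSettingW (d := d) F aminus aplus c β) := by
  obtain ⟨e₁, he₁, hsm⟩ := threshold_window ℓ ((d + 1) * c) ham hle hβ d
  refine ⟨min 2 aminus / 4, e₁, div_pos (lt_min two_pos ham) four_pos, he₁, ?_⟩
  intro i hreg he hle' Φ
  change 0 < i.e at he
  change i.e ≤ e₁ at hle'
  have ha : 0 < i.ak := ham.trans_le i.hak
  have hsm' : ℓ ^ 2 * ((d + 1) * c * i.e ^ β) ^ 2 * (d + 1) * (1 + i.ak * (d + 1)) ≤ min 2 i.ak / 4 := by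
    have := hsm i.e he hle' i.ak i.hak i.hak'
    simpa only [mul_assoc] using this
  have h := lower18_regular_region_printed F hℓ hLip he i.hn ha.le 0 i.Ωc hc hreg hsm' Φ
  have hΦ : 0 ≤ Φ ⬝ᵥ Φ := dotProduct_self_nonneg' Φ
  have h1 : min 2 aminus / 4 ≤ min 2 i.ak / 4 + 0 := by
    have h0 : min 2 aminus / 4 ≤ min 2 i.ak / 4 :=
      div_le_div_of_nonneg_right (min_le_min le_rfl i.hak) (by norm_num)
    linarith
  exact (mul_le_mul_of_nonneg_right h1 hΦ).trans h

/-- the window (1.8) for the ROTATION FLOW (`N = 2`, `ℓ = 1`). [cite: Balaban1983RegularityDecay, (1.8) p.573] -/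
theorem claim18Printed_regularRegionW_rot {aminus aplus : ℝ} (ham : 0 < aminus) (hle : aminus ≤ aplus) {c : ℝ}
    (hc : 0 ≤ c) {β : ℝ} (hβ : 0 < β) :
    B4.Claim18Printed (regularRegionSettingW (d := d) OrthFlow.rot aminus aplus c β) :=
  claim18Printed_regularRegionW OrthFlow.rot zero_le_one rot_lipschitz ham hle hc hβ

/-- the window (1.8) for the flow `U = e^{tq}` of (1.2), ANY antisymmetric `q`. [cite: Balaban1983RegularityDecay, (1.8) p.573; (1.2) p.572] -/
theorem claim18Printed_regularRegionW_exp (q : Matrix ι ι ℝ) (hq : qᵀ = -q) {aminus aplus : ℝ} (ham : 0 < aminus)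
    (hle : aminus ≤ aplus) {c : ℝ} (hc : 0 ≤ c) {β : ℝ} (hβ : 0 < β) :
    B4.Claim18Printed (regularRegionSettingW (d := d) (expFlow q hq) aminus aplus c β) :=
  claim18Printed_regularRegionW (expFlow q hq) (expFlow_ell_nonneg q) (expFlow_lipschitz q hq) ham hle hc hβ

end

end Literature.MathematicalPhysics.QuantumFieldTheory.Balaban1983to89.B4Lemma21RegularWindow
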